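import Literature.AnabelianGeometry.EtaleTheta.Discharge.Sec4GaloisLiftOfFullEssSurj
import Literature.AnabelianGeometry.EtaleTheta.DivisorMonoidsOfGaloisCoveringCoset
import Literature.AnabelianGeometry.SemiGraphs.CosetCategoriesBridge

/-!
# [EtTh] E2 (a) / A10 under RE-INDEXING of the Def. 3.3 (iii) data over the SMALL coset model `CosetCat G ≌ B^temp(G)⁰`
# (Def. 3.3 (iii) p.299, Def. 3.6 (i)(ii) pp.302–303, Prop. 4.2 (iii) p.315 / PDF pp.73, 76–77, 89)

S. Mochizuki, *The étale theta function …*, Publ. RIMS **45** (2009) [MochizukiEtTh2009], Def. 3.3 (iii) p.299 (PDF p.73), Def. 3.6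
(i)(ii) pp.302–303 (PDF pp.76–77) («equipped with a functor `D → D₀`»), Prop. 4.2 (iii) p.315 (PDF p.89) («admits an `N`-th root over
some tempered covering» — ERRATUM E2, [IUTchI] Rmk. 3.2.4 (i)(a)); S. Mochizuki, *The geometry of Frobenioids II* (2008), Ex. 1.3 (i) p.11
(connected objects of the temperoid = coset spaces `Π/U`).  [cite: MochizukiEtTh2009, Prop 4.2 (iii) p.315 (PDF p.89)]
PAGE CONVENTION for [EtTh]: «printed N (PDF p.M)», N = M + 226.

abc-iut cell, layer L2, seat abc-iut-L2-t3 (gen 9; E2 / A10 / `LogDivisorTower` owner lineage); self-named row «U1 SMALL-INDEX KIT» (STATUS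
2026-08-27T05:03Z) = the holder-independent half of repair (U1) for FINDING F-L2t3g9-1 (STATUS 04:53:52Z / 04:56:24Z): abc-iut-L2-t3's
`BiKummerSetting (X : TemperedArithmeticGroup.{u₀} K) {D₀ : Type u₀} …` pins the Def. 3.6 (i) index category `D₀` to the universe of the
field `K` (`TemperedCurve.K : Type 0` for the Setting), while every multi-level tower model of Def. 3.6 (ii) in the tree is indexed over the
LARGE connected temperoid `D₀ := ConnectedPart (BTemp G) : Type (u+1)` (`DivisorMonoids.ofTower`, the ζ-twist / Kummer–Tate / `(β)`-theta
towers) — so such a model enters a §4 setting over a `Type u` field only after RE-INDEXING its data over abc-iut-L5-t2's SMALL coset model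
`CosetCat G` (`Type u`) along the equivalence `CosetCat.toConnected hG : CosetCat G ⥤ B^temp(G)⁰` (abc-iut-w5-d179's
`DivisorMonoids.precomp`; the pattern of `ZTowerTempered` / `ThetaTowerTempered`, whose base functor is the equivalence inverse).
PROOF-ONLY (0 defs), nothing landed is edited; this file supplies what such a re-indexed model consumes BY NAME:
* §1 `DivisorMonoids.RootLaw.precomp_of_full_essSurj` — E2 (a) on the data (`RootLaw`, abc-iut-L2-t3 gen 5) SURVIVES precomposition
  along every full, essentially surjective functor `F : D₁ ⥤ D₀` (a root over a covering `Y' → F Y` is moved to the `F`-preimage of `Y'`);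
  `DivisorMonoids.isPerfFactorialCof_precomp` (Prop. 3.4 (i) slot, definitional);
* §2 `CosetCat.hLift_top_of_full_essSurj` / `CosetCat.hLift_galois_of_full_essSurj` — the covering lift of the proof of Prop. 4.2 (iii)
  («pass to a Galois closure») along ANY full, essentially surjective base functor `D ⥤ CosetCat G` (`G` tempered for the Galois form),
  transported from abc-iut-L2-t3 gen 5's `ConnectedPart.hLift_*_of_full_essSurj` through the fully faithful `toConnected`;
  `CosetCat.isGaloisObj_toConnected_inverse_iff` — the Galois predicate read through the equivalence and back;
* §3 `TemperedFrobenioid.baseRootLaw_galois_precomp_toConnected_of_rootLaw` (the `IG := ⊤` form is the landed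
  `baseRootLaw_top_of_rootLaw_of_full_essSurj`, whose statement does not see the index category) — **A10 `BaseRootLaw «Galois»` for every tempered
  Frobenioid over `ofRlfZWeak (dm.precomp (CosetCat.toConnected hG)) hpf` with full, essentially surjective base, from `dm.RootLaw` on the
  ORIGINAL (large-indexed) data**; the tower corollary `baseRootLaw_galois_ofTower_precomp_of_rootLaw` (E2 theorems of record such as
  `rootLawC₃sf` (p490708) feed it unchanged); `TemperedFrobenioid.BaseRootLaw.of_iff` and the headline
  `baseRootLaw_galoisObj_precomp_toConnected_of_rootLaw` for the §4 shape `D := B^temp(G)⁰`, base := the equivalence inverse, `IG A := «A Galois»`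
  (the Galois predicate of `BiKummerSetting.mkOfQuotientTemperoid` / `mkOfConnectedTemperoid`).
KERNEL CHECK OF THE ROUTE (probe `HOME/staging/L2/L2-t3/g9/probe/ProbeSmallIndexAtCompat3.lean`, rc 0, not filed): with the data of the
`(β)`-theta tower re-indexed as `(DivisorMonoids.ofTower towerC₃sf).precomp (CosetCat.toConnected isTempered_compat₃')`, a tempered Frobenioid
over them with base category `B^temp(Compat₃′)⁰` DOES enter `BiKummerSetting.mkOfQuotientTemperoidQuot X …` for `X : TemperedArithmeticGroup.{0} K`,
`K : Type` — the universe obstruction F-L2t3g9-1 is gone (abc-iut-L2-lead R1161: (U1) = the repair of record).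
HONEST FRAMING: implications between OUR typed predicates over abc-iut-L2-t3's / abc-iut-L5-t2's structures; no tower model is re-indexed
HERE (that is the model holder's file); typed ≠ proved; nothing here bears on [IUTchIII] Cor. 3.12.
-/

noncomputable section

open CategoryTheory Opposite Literature.AlgebraicGeometry.Frobenioids Literature.AlgebraicGeometry.Frobenioids.QuasiTemperoid
  Literature.AnabelianGeometry.SemiGraphs Literature.AnabelianGeometry.SemiGraphs.GaloisObjects

universe u₀ v₀ u₁ v₁ u v w

/-! ### §1 E2 (a) on the data survives re-indexing along a full, essentially surjective functor -/

namespace Literature.AnabelianGeometry.EtaleTheta.DivisorMonoids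

variable {D₀ : Type u} [Category.{v} D₀] (dm : DivisorMonoids.{u, v, w} D₀) {D₁ : Type u₁} [Category.{v₁} D₁]
  (F : D₁ ⥤ D₀)

/-- **E2 (a) `RootLaw` is stable under precomposition with a full, essentially surjective functor** `F : D₁ ⥤ D₀`: a root of
`b ∈ B₀(F Y)` over a covering `Y' → F Y` of `D₀` pulls back to the `F`-preimage `F Y₁ ≅ Y'` and the composite `F Y₁ → F Y` is `F c`
by fullness.  [cite: MochizukiEtTh2009, Def 3.3 (iii) p.299 (PDF p.73)] -/
theorem RootLaw.precomp_of_full_essSurj [F.Full] [F.EssSurj] (h : dm.RootLaw) : (dm.precomp F).RootLaw := by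
  refine ⟨fun N Y b => ?_⟩
  obtain ⟨Y', f, r, hr⟩ := h.exists_root N (F.obj Y) b
  refine ⟨F.objPreimage Y', F.preimage ((F.objObjPreimageIso Y').hom ≫ f), (dm.B₀.map (F.objObjPreimageIso Y').hom.op).hom r,
    (RootLaw.exists_root_over dm f (F.objObjPreimageIso Y').hom b r hr).trans ?_⟩
  change _ = (dm.B₀.map (F.map (F.preimage ((F.objObjPreimageIso Y').hom ≫ f))).op).hom b
  rw [F.map_preimage]

/-- The Prop. 3.4 (i) slot (`IsPerfFactorialCof` at every `Φ₀`) is inherited by the re-indexed data (definitionally `Φ₀(F Y)`).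
[cite: MochizukiEtTh2009, Prop 3.4 p.300 (PDF p.74)] -/
theorem isPerfFactorialCof_precomp (hpf : ∀ Y : D₀ᵒᵖ, IsPerfFactorialCof (dm.Φ₀.obj Y)) (Y : D₁ᵒᵖ) :
    IsPerfFactorialCof ((dm.precomp F).Φ₀.obj Y) :=
  hpf _

end Literature.AnabelianGeometry.EtaleTheta.DivisorMonoids

/-! ### §2 The covering lift of Prop. 4.2 (iii) along a base functor into the small coset model -/

namespace Literature.AnabelianGeometry.SemiGraphs.CosetCat

variable {G : Type u} [Group G] [TopologicalSpace G] {D : Type u₀} [Category.{v₀} D] (F : D ⥤ CosetCat G)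

/-- **`hLift` with `IG := ⊤` along a full, essentially surjective base functor `D ⥤ CosetCat G`** (pure category theory: dominate
`Y'` by its `F`-preimage).  [cite: MochizukiEtTh2009, Prop 4.2 (iii) p.315 (PDF p.89)] -/
theorem hLift_top_of_full_essSurj [F.Full] [F.EssSurj] :
    ∀ (X : D), True → ∀ (Y' : CosetCat G) (f : Y' ⟶ F.obj X),
      ∃ (X' : D) (_ : True) (c : X' ⟶ X) (g : F.obj X' ⟶ Y'), g ≫ f = F.map c := fun _ _ Y' f =>
  ⟨F.objPreimage Y', trivial, F.preimage ((F.objObjPreimageIso Y').hom ≫ f), (F.objObjPreimageIso Y').hom,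
    (F.map_preimage _).symm⟩

variable [IsTopologicalGroup G] (hG : IsTempered G)

/-- **`hLift` with `IG := «Galois»` along a full, essentially surjective base functor `D ⥤ CosetCat G`** (`G` tempered): abc-iut-L2-t3's
`ConnectedPart.hLift_galois_of_full_essSurj` for `F ⋙ toConnected` ([SemiAnbd] Rmk. 3.1.3: every covering is dominated by a Galois one),
pulled back through the fully faithful `toConnected : CosetCat G ⥤ B^temp(G)⁰`.  [cite: MochizukiEtTh2009, Prop 4.2 (iii) p.315 (PDF p.89)] -/
theorem hLift_galois_of_full_essSurj [F.Full] [F.EssSurj] :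
    ∀ (X : D), IsGaloisObj ((toConnected hG).obj (F.obj X)).obj → ∀ (Y' : CosetCat G) (f : Y' ⟶ F.obj X),
      ∃ (X' : D) (_ : IsGaloisObj ((toConnected hG).obj (F.obj X')).obj) (c : X' ⟶ X) (g : F.obj X' ⟶ Y'),
        g ≫ f = F.map c := by
  haveI := toConnected_full hG
  haveI := toConnected_faithful hG
  haveI := toConnected_essSurj hG
  intro X hX Y' f
  obtain ⟨X', hX', c, g', hg'⟩ :=
    Literature.AnabelianGeometry.EtaleTheta.ConnectedPart.hLift_galois_of_full_essSurj (F ⋙ toConnected hG) hG X hX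
      ((toConnected hG).obj Y') ((toConnected hG).map f)
  refine ⟨X', hX', c, (toConnected hG).preimage g', (toConnected hG).map_injective ?_⟩
  rw [Functor.map_comp, Functor.map_preimage]
  exact hg'

/-- **The Galois predicate through the equivalence and back**: for `A ∈ B^temp(G)⁰`, the coset space re-presenting `A`
(`toConnected (inverse A) ≅ A`, counit of `CosetCat G ≌ B^temp(G)⁰`) is Galois iff `A` is.  [cite: MochizukiSemiAnbd2006, Rmk 3.1.3 p.34] -/
theorem isGaloisObj_toConnected_inverse_iff (A : ConnectedPart (BTemp G)) :
    IsGaloisObj ((toConnected hG).obj ((equivConnectedPart hG).inverse.obj A)).obj ↔ IsGaloisObj A.obj := by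
  have e : (toConnected hG).obj ((equivConnectedPart hG).inverse.obj A) ≅ A := (equivConnectedPart hG).counitIso.app A
  exact ⟨fun h => GaloisObjects.isGaloisObj_of_iso hG ((connectedObjects (BTemp G)).ι.mapIso e.symm) h,
    fun h => GaloisObjects.isGaloisObj_of_iso hG ((connectedObjects (BTemp G)).ι.mapIso e) h⟩

end Literature.AnabelianGeometry.SemiGraphs.CosetCat

/-! ### §3 A10 `BaseRootLaw` for tempered Frobenioids over the small-indexed data -/

namespace Literature.AnabelianGeometry.EtaleTheta.TemperedFrobenioid

section OfIff

variable {D₀ : Type u₁} [Category.{v₁} D₀] {V : FrdIMonoidStub.{w}} {T : RealifiedDivisorMonoids (D₀ := D₀) V}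
  {D : Type u₀} [Category.{v₀} D] {VD : FrdICatStub.{u₀, v₀, w} D} (tf : TemperedFrobenioid T D VD)

/-- `BaseRootLaw` depends on the predicate `IG` only up to logical equivalence. [cite: MochizukiEtTh2009, Prop 4.2 (iii) p.315 (PDF p.89)] -/
theorem BaseRootLaw.of_iff {IG IG' : D → Prop} (hI : ∀ X, IG X ↔ IG' X) (h : tf.BaseRootLaw IG) : tf.BaseRootLaw IG' := by
  intro N A hA b
  obtain ⟨A', hA', c, b', hb'⟩ := h N A ((hI A).2 hA) b
  exact ⟨A', (hI A').1 hA', c, b', hb'⟩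

end OfIff

section Precomp

variable {G : Type u} [Group G] [TopologicalSpace G] [IsTopologicalGroup G] (hG : IsTempered G)
  {dm : DivisorMonoids.{u + 1, u, w} (ConnectedPart (BTemp G))}
  {hpf : ∀ Y : (CosetCat G)ᵒᵖ, IsPerfFactorialCof ((dm.precomp (CosetCat.toConnected hG)).Φ₀.obj Y)}
  {D : Type u₀} [Category.{v₀} D] {VD : FrdICatStub.{u₀, v₀, w} D}
  (tf : TemperedFrobenioid (RealifiedDivisorMonoids.ofRlfZWeak (dm.precomp (CosetCat.toConnected hG)) hpf) D VD)
  [tf.base.Full] [tf.base.EssSurj]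

/-- **A10 with `IG := «Galois»` (Def. 4.1 (ii)) for the SMALL-INDEXED data** `dm.precomp toConnected` (`G` tempered), from E2 (a) on the
original data `dm` over `B^temp(G)⁰`; the Galois predicate is read on the coset space `toConnected (Y_X)`.
[cite: MochizukiEtTh2009, Prop 4.2 (iii) p.315 (PDF p.89)] -/
theorem baseRootLaw_galois_precomp_toConnected_of_rootLaw (hR : dm.RootLaw) :
    tf.BaseRootLaw fun X => IsGaloisObj ((CosetCat.toConnected hG).obj (tf.base.obj X)).obj := by
  haveI := CosetCat.toConnected_full hG
  haveI := CosetCat.toConnected_essSurj hG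
  exact tf.baseRootLaw_of_rootLaw (hR.precomp_of_full_essSurj dm _) _ (CosetCat.hLift_galois_of_full_essSurj tf.base hG)

end Precomp

section InverseBase

variable {G : Type u} [Group G] [TopologicalSpace G] [IsTopologicalGroup G] (hG : IsTempered G)
  {dm : DivisorMonoids.{u + 1, u, w} (ConnectedPart (BTemp G))}
  {hpf : ∀ Y : (CosetCat G)ᵒᵖ, IsPerfFactorialCof ((dm.precomp (CosetCat.toConnected hG)).Φ₀.obj Y)}
  {VD : FrdICatStub.{u + 1, u, w} (ConnectedPart (BTemp G))}
  (tf : TemperedFrobenioid (RealifiedDivisorMonoids.ofRlfZWeak (dm.precomp (CosetCat.toConnected hG)) hpf)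
    (ConnectedPart (BTemp G)) VD)

/-- **A10 in the §4 shape of record**: for a tempered Frobenioid over the small-indexed data whose base category is `B^temp(G)⁰` itself and
whose base functor IS the equivalence inverse `B^temp(G)⁰ ⥤ CosetCat G` (the `ZTowerTempered` pattern), E2 (a) `dm.RootLaw` gives
`BaseRootLaw` for the Galois predicate `A ↦ «A Galois»` of `BiKummerSetting.mkOfQuotientTemperoid` / `mkOfConnectedTemperoid`.
[cite: MochizukiEtTh2009, Prop 4.2 (iii) p.315 (PDF p.89)] -/
theorem baseRootLaw_galoisObj_precomp_toConnected_of_rootLaw (hbase : tf.base = (CosetCat.equivConnectedPart hG).inverse)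
    (hR : dm.RootLaw) : tf.BaseRootLaw fun A => IsGaloisObj A.obj := by
  haveI : tf.base.Full := by rw [hbase]; infer_instance
  haveI : tf.base.EssSurj := by rw [hbase]; infer_instance
  refine BaseRootLaw.of_iff tf (fun A => ?_) (tf.baseRootLaw_galois_precomp_toConnected_of_rootLaw hG hR)
  rw [hbase]
  exact CosetCat.isGaloisObj_toConnected_inverse_iff hG A

end InverseBase

section Tower

variable {P : Type u} [Group P] [TopologicalSpace P] [IsTopologicalGroup P] (hP : IsTempered P) {L : LevelSystem P}
  (T : LogDivisorTower P L)
  {hpf : ∀ Y : (CosetCat P)ᵒᵖ, IsPerfFactorialCof (((DivisorMonoids.ofTower T).precomp (CosetCat.toConnected hP)).Φ₀.obj Y)}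
  {D : Type u₀} [Category.{v₀} D] {VD : FrdICatStub.{u₀, v₀, u} D}
  (tf : TemperedFrobenioid (RealifiedDivisorMonoids.ofRlfZWeak ((DivisorMonoids.ofTower T).precomp (CosetCat.toConnected hP)) hpf) D VD)
  [tf.base.Full] [tf.base.EssSurj]

/-- **A10 at the SMALL-INDEXED v2 tower datum** `(ofTower T).precomp toConnected`: E2 (a) `RootLaw (ofTower T)` (e.g. `rootLawC₃sf`, p490708)
implies `BaseRootLaw «Galois»` for every tempered Frobenioid over it with full, essentially surjective base — the companion of
`baseRootLaw_galois_ofTower_of_rootLaw` for the tower models that can enter a §4 setting over a `Type u` field.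
[cite: MochizukiEtTh2009, Prop 4.2 (iii) p.315 (PDF p.89)] -/
theorem baseRootLaw_galois_ofTower_precomp_of_rootLaw (hR : (DivisorMonoids.ofTower T).RootLaw) :
    tf.BaseRootLaw fun X => IsGaloisObj ((CosetCat.toConnected hP).obj (tf.base.obj X)).obj :=
  tf.baseRootLaw_galois_precomp_toConnected_of_rootLaw hP hR

end Tower

end Literature.AnabelianGeometry.EtaleTheta.TemperedFrobenioid

end
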